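import Summits.BirchSwinnertonDyer.BirchSwinnertonDyer.Theorems.ClassRecordThreeShimuraKolyvaginOrderBoundAtThreeSurjOrderEntry
import Summits.BirchSwinnertonDyer.BirchSwinnertonDyer.Theorems.ClassRecordThreeShimuraKolyvaginOrderBoundAtThreeSurjOrderReciprocity
import Summits.BirchSwinnertonDyer.BirchSwinnertonDyer.Theorems.SemiOrdinaryEisensteinDescentShaTwoCochainShell
import Summits.BirchSwinnertonDyer.BirchSwinnertonDyer.Theorems.SemiOrdinaryEisensteinDescentShaTwoCochainBridgeAssemblyCriterion
import Summits.BirchSwinnertonDyer.BirchSwinnertonDyer.Theorems.SemiOrdinaryEisensteinDescentShaTwoCochainClassReadout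
import Literature.NumberTheory.EllipticCurves.HeegnerPointsKolyvaginExceptionalSelmerProofs
import Literature.NumberTheory.EllipticCurves.HeegnerPointsKolyvaginPrimaryGeneratorProofs
import Literature.NumberTheory.EllipticCurves.WeilPairingProofs
import Literature.NumberTheory.EllipticCurves.ZywinaCMImageProofs
import Literature.NumberTheory.EllipticCurves.BSDRootNumberSmallConductorProofs
import Literature.NumberTheory.Automorphic.ChebotarevArtinRepHolds
import Literature.NumberTheory.GaloisCohomology.PoitouTateNumberField
import HarnessLib

/-!
# Kolyvagin's bound in DIVISIBILITY form, `#Ш(E/K)[p^∞] ∣ p^{2·ord_p [E(K) : ℤP]}`, for an ABSTRACT Euler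
# system of Heegner type attached to a non-torsion point `P ∈ E(K)` of finite index — all duality inputs
# DISCHARGED by tree theorems (crux stmt-BirchSwinnertonDyer-19357 `GordTwoRankZeroOffCaseOne`, line
# `three_field_road`, the PROVED half of the re-cut stub U-b; helper, `--supports`; BSD is not proved for any curve)

HONEST FRAMING: TWO THEOREMS and one private lemma (no definition, no named fact, no `sorry`); nothing booked.
Both are CONDITIONAL only on the displayed Euler-system input and prove no case of BSD:
* `card_sha_primaryComponent_dvd_pow_index_of_leaves` — GRANTED the levelwise CLASS-level leaves `hleaves`
  (Kolyvagin classes `cl` attached to `P` at every level `p^M` with leaf (A) eigen-sign / Selmer off `m` /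
  `λ`-switch, (B), (B₂): the hypothesis of the tree's conductor-keyed one-prime machine
  `ShimuraKolyvaginOrder.card_sha_primary_le_at_of_leavesM₂_of_localDuality_of_conductorNorm`
  (`ClassRecordThreeShimuraKolyvaginOrderBoundAtThreeSurjOrderAtPrime`, bsd-stepL), verbatim);
* `card_sha_primaryComponent_dvd_pow_index_of_points` — GRANTED only the POINT-level Heegner-type data
  `hpoints` (per level `p^M`: admissible modules `A m`, points `P_m ∈ invPoints (A m) p^M` with `P_1 = P`,
  the eigen relation under a lift of complex conjugation, the Selmer condition of the Kolyvagin class off `m`,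
  McCallum's Prop. 4.4 switch at `λ ∣ m` — the hypothesis of the tree's
  `ShimuraKolyvaginOrder.card_sha_primary_le_at_of_pointsM_of_reciprocityFinset_of_localDuality_of_conductorNorm`,
  verbatim): the output of Kolyvagin's derivative construction on ANY Euler system of Heegner type for `E`
  over `K` (McCallum §4), e.g. a system TRANSPORTED from the Heegner points of another curve along a twist.
For `E/ℚ` elliptic of conductor `N₀`, `K` imaginary quadratic, `p` odd with `ρ̄_{E,p}` onto, `P` non-torsion
of FINITE index: `Ш(E/K)[p^∞]` is finite and `#Ш(E/K)[p^∞] ∣ p^{2·ord_p [E(K) : ℤP]}`. Every other input is a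
TREE THEOREM discharged here: Weil pairings (`exists_weilPairing_holds`), Čebotarev (`chebotarev_artinRep_holds`),
Kolyvagin reciprocity in pairing form (`kolyvaginReciprocityFinset_of_poitouTate_of_conductorNorm` with
`poitouTate_sum_localTatePairing_eq_zero_holds`), hence leaves (B), (B₂)
(`hdual[₂]_of_kolyvaginReciprocityFinset_of_conductorNorm`), the levelwise Cassels–Tate inputs (the Ш²-cochain
bridge of `ShaTwoCochainTheta`, Milne ADT I §6, re-composed from its route-independent parts), `M₀ = ord_p P`
(`exists_pow_smul_eq_and_forall_ne`), non-CM from `ρ̄` onto (`not_hasSurjectiveModNGaloisRep_of_hasCM`), the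
case `p ∤ P` by Gross's §10 descent from local data (`card_selmerGroup_eq_of_localData`: `Sel_p = ℤ δP`, so
`Ш[p] = 0`), the case `p ∣ P` by McCallum's descent, and `p^{M₀} ∣ [E(K) : ℤP]`.

WHY (`Cruxes/GordTwoRankZeroOffCaseOne/LeadReport1.md`, `PenDecision1.md`): stub U-b of the three-field road =
`card_sha_primaryComponent_dvd_pow_index_of_points` ∘ (the genus-transported system's `hpoints`, the line's
declared residual: CM theory on `X₀(N_{E′})`, Eichler–Shimura, Néron models at `λ`, transported — not in print).
(Kernel: bsd-stepL's conductor-keyed chain `ClassRecordThreeShimuraKolyvaginOrderBoundAtThreeSurjOrder*`.)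

References: [cite: McCallumLMS1991, §§1–5] [cite: GrossLMS1991, §§2–10] [cite: MilneADT2006, Ch. I Thm. 4.10, §6].
-/

noncomputable section

open scoped Classical Pointwise

-- every file of `Summits/BirchSwinnertonDyer/BirchSwinnertonDyer/Theorems/` lives in this namespace
set_option linter.dupNamespace false

namespace Summit.BirchSwinnertonDyer.BirchSwinnertonDyer.Theorems.AbstractKolyvaginOrder
open WeierstrassCurve NumberField IsDedekindDomain Field Function
open Literature.NumberTheory.EllipticCurves Literature.NumberTheory.EllipticCurves.KolyvaginDescent
open Literature.NumberTheory.GaloisRepresentations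
open Literature.NumberTheory.GaloisCohomology
open Literature.NumberTheory.GaloisRepresentations.DiscreteGaloisModule (mu MuCarrier)
open Summit.BirchSwinnertonDyer.Rank1Residual.X11b
open Summit.BirchSwinnertonDyer.Rank1Residual.X11b.KolyvaginCT
open Summit.BirchSwinnertonDyer.BirchSwinnertonDyer.Theorems.ShimuraKolyvaginOrder
-- Cup products need `LocallyCompactSpace Γ_K`, the local terms `CharZero` completions (as in the tree's files).
attribute [local instance] absoluteGaloisGroup_compactSpace charZero_placeCompletion

/-- For `Q` of infinite order and any `n`, `n ∣ [G : ℤ(n•Q)]` (index `0` read as `∞`;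
`[G : ℤ nQ] = [G : ℤQ]·[ℤQ : ℤ nQ]` and `ℤQ ≅ ℤ`). [folklore] -/
private theorem dvd_index_zmultiples_nsmul {G : Type*} [AddCommGroup G] (Q : G)
    (hQ : ¬ IsOfFinAddOrder Q) (n : ℕ) : n ∣ (AddSubgroup.zmultiples (n • Q)).index := by
  set H := AddSubgroup.zmultiples (n • Q) with hH
  have hHK : H ≤ AddSubgroup.zmultiples Q :=
    AddSubgroup.zmultiples_le_of_mem
      ((AddSubgroup.zmultiples Q).nsmul_mem (AddSubgroup.mem_zmultiples Q) n)
  have h1 : H.relIndex (AddSubgroup.zmultiples Q) ∣ H.index :=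
    ⟨_, (AddSubgroup.relIndex_mul_index hHK).symm⟩
  refine dvd_trans ?_ h1
  have h2 : H.relIndex (AddSubgroup.zmultiples Q) = (H.comap (zmultiplesHom G Q)).index := by
    rw [← AddSubgroup.range_zmultiplesHom, AddMonoidHom.range_eq_map, ← AddSubgroup.relIndex_comap,
      AddSubgroup.relIndex_top_right]
  rw [h2]
  have h3 : H.comap (zmultiplesHom G Q) = AddSubgroup.zmultiples (n : ℤ) := by
    ext k
    simp only [AddSubgroup.mem_comap, zmultiplesHom_apply, hH, AddSubgroup.mem_zmultiples_iff]
    constructor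
    · rintro ⟨m, hm⟩
      refine ⟨m, ?_⟩
      have h : (m * (n : ℤ)) • Q = k • Q := by rw [mul_smul, natCast_zsmul, hm]
      have hinj := injective_zsmul_iff_not_isOfFinAddOrder.mpr hQ
      have := hinj h
      simpa [smul_eq_mul] using this
    · rintro ⟨m, rfl⟩
      exact ⟨m, by rw [smul_eq_mul, mul_smul, natCast_zsmul]⟩
  rw [h3, Int.index_zmultiples, Int.natAbs_natCast]

/-- The levelwise Cassels–Tate inputs for THE canonical invariant maps, every number field (Milne ADT I §6):
the composition of the tree's Ш²-cochain bridge (`ShaTwoCochainTheta.casselsTate_levelInputs_of_shaTwoCochainBridge`,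
re-composed here from its three route-independent parts to keep this file out of any Theses cone).
[cite: MilneADT2006, Ch. I, Thm. 4.10 (a), §6 Prop. 6.9, Thm. 6.13 (a)] -/
private theorem casselsTate_levelInputs_canonical (K : Type) [Field K] [NumberField K] :
    casselsTate_levelInputs K :=
  ShaTwoCochainTheta.casselsTate_levelInputs_of_readout_vanishing_flip K
    (ShaTwoCochainTheta.hbridge_of_readout_criterion K
      (ShaTwoCochain.classBarInv_readout_eq_zero_of_criterion K))

variable (W : WeierstrassCurve ℚ) {K : Type} [Field K] [NumberField K]

/-- **Kolyvagin's bound in divisibility form for an ABSTRACT system of CLASSES attached to a point of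
finite index** (McCallum 1991 §1 Theorem / Cor. 5.6 for `p ∣ [E(K):ℤP]`, Gross 1991 Prop. 2.1 / §10
for `p ∤ [E(K):ℤP]`): `Ш(E/K)[p^∞]` is finite and `#Ш(E/K)[p^∞] ∣ p^{2·ord_p [E(K) : ℤP]}`, GRANTED the
levelwise CLASS-level leaves `hleaves` for the classes attached to `P`; conductor-keyed (`N_E = N₀`);
every duality input discharged by tree theorems (module docstring). [cite: McCallumLMS1991, §1 Theorem (Kolyvagin),
Lemma 5.1, Thm. 5.4, Cor. 5.6] [cite: GrossLMS1991, §2 Prop. 2.1, Thm. 2.2 (2), §10]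
[cite: MilneADT2006, Ch. I §6, Prop. 6.9, Thm. 6.13(a)] -/
theorem card_sha_primaryComponent_dvd_pow_index_of_leaves [W.IsElliptic]
    (hK : IsImaginaryQuadratic K) {N₀ : ℕ} [NeZero N₀] (hN : W.conductorNorm ℤ = N₀)
    {Pt : (W.baseChange K).toAffine.Point} {p : ℕ}
    (hnt : ¬ IsOfFinAddOrder Pt) (hp : p.Prime) (hp2 : p ≠ 2)
    (hρ : W.HasSurjectiveModNGaloisRep p)
    (hidx : (AddSubgroup.zmultiples Pt).index ≠ 0)
    (hleaves : ∀ {M : ℕ} (_hM : 1 ≤ M)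
      (hdiv : ∀ Q : geomPoints (W.baseChange K), ∃ R, ((p ^ M : ℕ) : ℤ) • R = Q)
      (c : K ≃ₐ[ℚ] K) (_hc : c ≠ 1),
      ∃ (ε : ℤ) (cl : ℕ → galH1Torsion (W.baseChange K) ((p ^ M : ℕ) : ℤ)),
        (ε = 1 ∨ ε = -1) ∧
        IsOfFinAddOrder (Affine.Point.map (W' := W) (c : K →ₐ[ℚ] K) Pt - ε • Pt) ∧
        cl 1 = kummerMapTorsion (W.baseChange K) _ hdiv Pt ∧
        (∀ m : ℕ, Squarefree m →
          (∀ q ∈ m.primeFactors, IsKolyvaginPrime N₀ W K p q ∧ FrobEqFrobInfty W K (p ^ M) q) →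
          conjAct W c _ (cl m) = (ε * (-1) ^ m.primeFactors.card) • cl m ∧
          (∀ v : HeightOneSpectrum (𝓞 K), (m : 𝓞 K) ∉ v.asIdeal →
            cl m ∈ selmerLocalKer (W.baseChange K) (v.adicCompletion K) ((p ^ M : ℕ) : ℤ)) ∧
          (∀ ℓ : ℕ, ℓ.Prime → ℓ ∣ m → ∀ v : HeightOneSpectrum (𝓞 K), (ℓ : 𝓞 K) ∈ v.asIdeal →
            ∀ a : ℕ, (((p : ℤ) ^ a) • cl m ∈
                selmerLocalKer (W.baseChange K) (v.adicCompletion K) ((p ^ M : ℕ) : ℤ) ↔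
              ((p : ℤ) ^ a) • cl (m / ℓ) ∈
                (W.baseChange K).torsionLocalKer (v.adicCompletion K) ((p ^ M : ℕ) : ℤ)))) ∧
        (∀ ℓ : ℕ, IsKolyvaginPrime N₀ W K p ℓ ∧ FrobEqFrobInfty W K (p ^ M) ℓ →
          ∀ ν : ℤ, (ν = 1 ∨ ν = -1) → ∀ d : galH1Torsion (W.baseChange K) ((p ^ M : ℕ) : ℤ),
          conjAct W c _ d = ν • d →
          (∀ v : HeightOneSpectrum (𝓞 K), (ℓ : 𝓞 K) ∉ v.asIdeal →
            d ∈ selmerLocalKer (W.baseChange K) (v.adicCompletion K) ((p ^ M : ℕ) : ℤ)) →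
          (∀ w : InfinitePlace K,
            d ∈ selmerLocalKer (W.baseChange K) w.Completion ((p ^ M : ℕ) : ℤ)) →
          ∀ s ∈ selmerGroup (W.baseChange K) ((p ^ M : ℕ) : ℤ), conjAct W c _ s = ν • s →
          ∀ a : ℕ, a < M → ∀ v : HeightOneSpectrum (𝓞 K), (ℓ : 𝓞 K) ∈ v.asIdeal →
            ((p : ℤ) ^ a) • d ∉
              selmerLocalKer (W.baseChange K) (v.adicCompletion K) ((p ^ M : ℕ) : ℤ) →
            ((p : ℤ) ^ (M - 1 - a)) • s ∈
              (W.baseChange K).torsionLocalKer (v.adicCompletion K) ((p ^ M : ℕ) : ℤ)) ∧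
        (∀ ℓ ℓ' : ℕ, IsKolyvaginPrime N₀ W K p ℓ ∧ FrobEqFrobInfty W K (p ^ M) ℓ →
          IsKolyvaginPrime N₀ W K p ℓ' ∧ FrobEqFrobInfty W K (p ^ M) ℓ' → ℓ ≠ ℓ' →
          ∀ ν : ℤ, (ν = 1 ∨ ν = -1) → ∀ d : galH1Torsion (W.baseChange K) ((p ^ M : ℕ) : ℤ),
          conjAct W c _ d = ν • d →
          (∀ v : HeightOneSpectrum (𝓞 K), (ℓ : 𝓞 K) ∉ v.asIdeal → (ℓ' : 𝓞 K) ∉ v.asIdeal →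
            d ∈ selmerLocalKer (W.baseChange K) (v.adicCompletion K) ((p ^ M : ℕ) : ℤ)) →
          (∀ w : InfinitePlace K,
            d ∈ selmerLocalKer (W.baseChange K) w.Completion ((p ^ M : ℕ) : ℤ)) →
          ∀ s ∈ selmerGroup (W.baseChange K) ((p ^ M : ℕ) : ℤ), conjAct W c _ s = ν • s →
          (∀ v : HeightOneSpectrum (𝓞 K), (ℓ' : 𝓞 K) ∈ v.asIdeal →
            s ∈ (W.baseChange K).torsionLocalKer (v.adicCompletion K) ((p ^ M : ℕ) : ℤ)) →
          ∀ a : ℕ, a < M → ∀ v : HeightOneSpectrum (𝓞 K), (ℓ : 𝓞 K) ∈ v.asIdeal →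
            ((p : ℤ) ^ a) • d ∉
              selmerLocalKer (W.baseChange K) (v.adicCompletion K) ((p ^ M : ℕ) : ℤ) →
            ((p : ℤ) ^ (M - 1 - a)) • s ∈
              (W.baseChange K).torsionLocalKer (v.adicCompletion K) ((p ^ M : ℕ) : ℤ))) :
    Finite (AddCommGroup.primaryComponent (W.baseChange K).sha p) ∧
    Nat.card (AddCommGroup.primaryComponent (W.baseChange K).sha p) ∣
      p ^ (2 * padicValNat p (AddSubgroup.zmultiples Pt).index) := by
  haveI : Fact p.Prime := ⟨hp⟩
  haveI : (W.baseChange K).IsElliptic := inferInstanceAs (W.map (algebraMap ℚ K)).IsElliptic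
  haveI : Module.Finite ℤ (W.baseChange K).toAffine.Point :=
    (W.baseChange K).module_finite_point_holds
  obtain ⟨c, hc, hcc⟩ := exists_conj_of_isImaginaryQuadratic K hK
  have hE : ¬ W.HasCM := fun hCM => W.not_hasSurjectiveModNGaloisRep_of_hasCM hCM hp hp2 hρ
  -- `M₀ = ord_p P` and `x₀` with `P = p^{M₀} x₀ ∉ p^{M₀+1} E(K)` (McCallum Lemma 5.1)
  obtain ⟨M₀, x₀, hx₀, hmax⟩ :=
    exists_pow_smul_eq_and_forall_ne (A := (W.baseChange K).toAffine.Point) hnt hp.two_le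
  -- `p^{M₀} ∣ [E(K) : ℤP]`, so `M₀ ≤ ord_p [E(K) : ℤP]`
  have hx₀nt : ¬ IsOfFinAddOrder x₀ := fun h => hnt (hx₀ ▸ h.nsmul)
  have hM₀le : M₀ ≤ padicValNat p (AddSubgroup.zmultiples Pt).index := by
    have hdvd : p ^ M₀ ∣ (AddSubgroup.zmultiples Pt).index := by
      rw [← hx₀]
      exact dvd_index_zmultiples_nsmul x₀ hx₀nt (p ^ M₀)
    exact (padicValNat_dvd_iff_le hidx).mp hdvd
  have hpow : ∀ {k : ℕ}, Nat.card (AddCommGroup.primaryComponent (W.baseChange K).sha p) = p ^ k →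
      k ≤ 2 * M₀ → Nat.card (AddCommGroup.primaryComponent (W.baseChange K).sha p) ∣
        p ^ (2 * padicValNat p (AddSubgroup.zmultiples Pt).index) := by
    intro k hk hkle
    rw [hk]
    exact pow_dvd_pow p (by omega)
  rcases Nat.eq_zero_or_pos M₀ with hM0 | hMpos
  · /- `p ∤ P`: Gross's §10 descent from the per-prime local data at level `p` gives
       `Sel(E/K)_p = ℤ δP`, hence `Ш(E/K)[p] = 0` and `Ш(E/K)[p^∞] = 0`. -/
    subst hM0
    have hndiv : ¬ ∃ Q : (W.baseChange K).toAffine.Point, p • Q = Pt := by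
      rintro ⟨Q, hQ⟩
      exact hmax Q (by simpa using hQ)
    have hp0 : ((p : ℕ) : ℤ) ≠ 0 := by exact_mod_cast hp.ne_zero
    let hdiv₀ : ∀ Q : geomPoints (W.baseChange K), ∃ R, ((p : ℕ) : ℤ) • R = Q :=
      (W.baseChange K).zsmul_geomPoints_surjective_of_charZero hp0
    -- the leaves at level `p = p^1`, read through a level-generic restatement (by `Iff.rfl`)
    obtain ⟨Φ, hΦ⟩ : ∃ Φ : ℕ → ℕ → Prop, ∀ M n : ℕ, (Φ M n ↔ ∀
          (hdiv : ∀ Q : geomPoints (W.baseChange K), ∃ R, ((n : ℕ) : ℤ) • R = Q)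
          (c : K ≃ₐ[ℚ] K) (_hc : c ≠ 1),
          ∃ (ε : ℤ) (cl : ℕ → galH1Torsion (W.baseChange K) ((n : ℕ) : ℤ)),
            (ε = 1 ∨ ε = -1) ∧
            IsOfFinAddOrder (Affine.Point.map (W' := W) (c : K →ₐ[ℚ] K) Pt - ε • Pt) ∧
            cl 1 = kummerMapTorsion (W.baseChange K) _ hdiv Pt ∧
            (∀ m : ℕ, Squarefree m →
              (∀ q ∈ m.primeFactors, IsKolyvaginPrime N₀ W K p q ∧ FrobEqFrobInfty W K n q) →
              conjAct W c _ (cl m) = (ε * (-1) ^ m.primeFactors.card) • cl m ∧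
              (∀ v : HeightOneSpectrum (𝓞 K), (m : 𝓞 K) ∉ v.asIdeal →
                cl m ∈ selmerLocalKer (W.baseChange K) (v.adicCompletion K) ((n : ℕ) : ℤ)) ∧
              (∀ ℓ : ℕ, ℓ.Prime → ℓ ∣ m → ∀ v : HeightOneSpectrum (𝓞 K), (ℓ : 𝓞 K) ∈ v.asIdeal →
                ∀ a : ℕ, (((p : ℤ) ^ a) • cl m ∈
                    selmerLocalKer (W.baseChange K) (v.adicCompletion K) ((n : ℕ) : ℤ) ↔
                  ((p : ℤ) ^ a) • cl (m / ℓ) ∈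
                    (W.baseChange K).torsionLocalKer (v.adicCompletion K) ((n : ℕ) : ℤ)))) ∧
            (∀ ℓ : ℕ, IsKolyvaginPrime N₀ W K p ℓ ∧ FrobEqFrobInfty W K n ℓ →
              ∀ ν : ℤ, (ν = 1 ∨ ν = -1) → ∀ d : galH1Torsion (W.baseChange K) ((n : ℕ) : ℤ),
              conjAct W c _ d = ν • d →
              (∀ v : HeightOneSpectrum (𝓞 K), (ℓ : 𝓞 K) ∉ v.asIdeal →
                d ∈ selmerLocalKer (W.baseChange K) (v.adicCompletion K) ((n : ℕ) : ℤ)) →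
              (∀ w : InfinitePlace K,
                d ∈ selmerLocalKer (W.baseChange K) w.Completion ((n : ℕ) : ℤ)) →
              ∀ s ∈ selmerGroup (W.baseChange K) ((n : ℕ) : ℤ), conjAct W c _ s = ν • s →
              ∀ a : ℕ, a < M → ∀ v : HeightOneSpectrum (𝓞 K), (ℓ : 𝓞 K) ∈ v.asIdeal →
                ((p : ℤ) ^ a) • d ∉
                  selmerLocalKer (W.baseChange K) (v.adicCompletion K) ((n : ℕ) : ℤ) →
                ((p : ℤ) ^ (M - 1 - a)) • s ∈
                  (W.baseChange K).torsionLocalKer (v.adicCompletion K) ((n : ℕ) : ℤ)) ∧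
            (∀ ℓ ℓ' : ℕ, IsKolyvaginPrime N₀ W K p ℓ ∧ FrobEqFrobInfty W K n ℓ →
              IsKolyvaginPrime N₀ W K p ℓ' ∧ FrobEqFrobInfty W K n ℓ' → ℓ ≠ ℓ' →
              ∀ ν : ℤ, (ν = 1 ∨ ν = -1) → ∀ d : galH1Torsion (W.baseChange K) ((n : ℕ) : ℤ),
              conjAct W c _ d = ν • d →
              (∀ v : HeightOneSpectrum (𝓞 K), (ℓ : 𝓞 K) ∉ v.asIdeal → (ℓ' : 𝓞 K) ∉ v.asIdeal →
                d ∈ selmerLocalKer (W.baseChange K) (v.adicCompletion K) ((n : ℕ) : ℤ)) →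
              (∀ w : InfinitePlace K,
                d ∈ selmerLocalKer (W.baseChange K) w.Completion ((n : ℕ) : ℤ)) →
              ∀ s ∈ selmerGroup (W.baseChange K) ((n : ℕ) : ℤ), conjAct W c _ s = ν • s →
              (∀ v : HeightOneSpectrum (𝓞 K), (ℓ' : 𝓞 K) ∈ v.asIdeal →
                s ∈ (W.baseChange K).torsionLocalKer (v.adicCompletion K) ((n : ℕ) : ℤ)) →
              ∀ a : ℕ, a < M → ∀ v : HeightOneSpectrum (𝓞 K), (ℓ : 𝓞 K) ∈ v.asIdeal →
                ((p : ℤ) ^ a) • d ∉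
                  selmerLocalKer (W.baseChange K) (v.adicCompletion K) ((n : ℕ) : ℤ) →
                ((p : ℤ) ^ (M - 1 - a)) • s ∈
                  (W.baseChange K).torsionLocalKer (v.adicCompletion K) ((n : ℕ) : ℤ))) :=
      ⟨fun M n => _, fun M n => Iff.rfl⟩
    have hL1 : Φ 1 (p ^ 1) := (hΦ 1 (p ^ 1)).mpr (fun hdiv c' hc' => hleaves le_rfl hdiv c' hc')
    rw [pow_one] at hL1
    obtain ⟨ε, cl, hε, -, hc1, hA, hB, -⟩ := (hΦ 1 p).mp hL1 hdiv₀ c hc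
    have hinfty : ∀ (w : InfinitePlace K) (d : galH1Torsion (W.baseChange K) ((p : ℕ) : ℤ)),
        d ∈ selmerLocalKer (W.baseChange K) w.Completion ((p : ℕ) : ℤ) := by
      intro w d
      haveI : IsAlgClosed w.Completion :=
        isAlgClosed_of_ringEquiv (InfinitePlace.Completion.ringEquivComplexOfIsComplex
          (hK.2.isComplex w)).symm
      rw [WeierstrassCurve.selmerLocalKer_eq_top_of_isAlgClosed]
      trivial
    have hSel := (card_selmerGroup_eq_of_localData (N := N₀) (W := W) hK hp hp2 hndiv c
      ⟨ε, cl, hε, hc1, fun n hn hq => by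
        have hq' : ∀ q ∈ n.primeFactors, IsKolyvaginPrime N₀ W K p q ∧ FrobEqFrobInfty W K p q :=
          fun q hq0 => ⟨hq q hq0, (hq q hq0).2.2.2.2.2⟩
        refine ⟨(hA n hn hq').1, (hA n hn hq').2.1, fun w => hinfty w _, fun ℓ hℓ hℓn v hv => ?_⟩
        have h := (hA n hn hq').2.2 ℓ hℓ hℓn v hv 0
        simpa only [pow_zero, one_smul] using h⟩
      (fun {ℓ} hℓ ν hν d hd hfin _hinf v hv hdv s hs hτs => by
        have h := hB ℓ ⟨hℓ, hℓ.2.2.2.2.2⟩ ν hν d hd hfin (fun w => hinfty w _) s hs hτs 0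
          Nat.one_pos v hv (by simpa only [pow_zero, one_smul] using hdv)
        simpa only [Nat.sub_self, pow_zero, one_smul] using h)
      (fun r cs hτ Nv hN hind =>
        McCallum1991_cor_3_2_eigen_holds N₀ W K hE hK hp hp2 hρ c hc r cs hτ Nv hN hind)).2
    -- `Ш(E/K)[p] = 0`
    have hShap : ∀ a : (W.baseChange K).sha, p • a = 0 → a = 0 := by
      intro a ha
      have hmap := (W.baseChange K).map_torsionH1ToH1_selmerGroup_holds (n := ((p : ℕ) : ℤ)) hp0
      have ha' : (a : (W.baseChange K).galH1) ∈
          (W.baseChange K).sha ⊓ AddSubgroup.torsionBy (W.baseChange K).galH1 ((p : ℕ) : ℤ) := by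
        refine ⟨a.2, AddSubgroup.torsionBy.nsmul_iff.mpr ?_⟩
        rw [← AddSubgroupClass.coe_nsmul, ha, ZeroMemClass.coe_zero]
      rw [← hmap, AddSubgroup.mem_map] at ha'
      obtain ⟨s, hs, hts⟩ := ha'
      rw [hSel, AddSubgroup.mem_zmultiples_iff] at hs
      obtain ⟨k, rfl⟩ := hs
      apply Subtype.ext
      rw [← hts, map_zsmul]
      have h0 : torsionH1ToH1 (W.baseChange K) _ (kummerClassOfPoint W K hp Pt) = 0 :=
        torsionH1ToH1_kummerMapTorsion (W.baseChange K) _ _ Pt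
      rw [h0, zsmul_zero, ZeroMemClass.coe_zero]
    -- hence `Ш(E/K)[p^∞] = 0`
    have hbot : ∀ a ∈ AddCommGroup.primaryComponent (W.baseChange K).sha p, a = 0 := by
      intro a ha
      obtain ⟨k, hk⟩ := (AddCommGroup.mem_primaryComponent).mp ha
      induction k generalizing a with
      | zero => simpa using hk
      | succ k ih =>
        have h1 : p ^ k • a ∈ AddCommGroup.primaryComponent (W.baseChange K).sha p :=
          AddSubgroup.nsmul_mem _ ha _
        have h2 : p • (p ^ k • a) = 0 := by rw [smul_smul, ← pow_succ', hk]
        have h3 := hShap _ h2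
        exact ih a ha h3
    have hsub : Subsingleton (AddCommGroup.primaryComponent (W.baseChange K).sha p) :=
      ⟨fun a b => Subtype.ext ((hbot a.1 a.2).trans (hbot b.1 b.2).symm)⟩
    haveI : Finite (AddCommGroup.primaryComponent (W.baseChange K).sha p) := Finite.of_subsingleton
    refine ⟨‹_›, ?_⟩
    rw [Nat.card_of_subsingleton (0 : AddCommGroup.primaryComponent (W.baseChange K).sha p)]
    exact one_dvd _
  · /- `p ∣ P`: McCallum's descent at level `M = 2M₀` for the abstract system, with the Weil
       pairing on `E[p^{2M₀}]` and the Cassels–Tate inputs of `casselsTate_levelInputs K`. -/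
    haveI : NeZero (p ^ M₀) := ⟨pow_ne_zero _ hp.ne_zero⟩
    have hn0 : ((p ^ M₀ * p ^ M₀ : ℕ) : K) ≠ 0 := by
      exact_mod_cast mul_ne_zero (pow_ne_zero _ hp.ne_zero) (pow_ne_zero _ hp.ne_zero)
    have h2le : 2 ≤ p ^ M₀ * p ^ M₀ :=
      le_trans hp.two_le (le_trans (Nat.le_self_pow (by omega) p) (Nat.le_mul_of_pos_right _
        (pos_of_gt (Nat.one_lt_pow (by omega) hp.one_lt))))
    obtain ⟨e, hμ, hadd₁, hadd₂, halt, hnondeg, hgal⟩ :=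
      exists_weilPairing_holds (W.baseChange K) (p ^ M₀ * p ^ M₀) h2le hn0
    obtain ⟨inv, hPT', hH3, hperf, hB, hPτ⟩ :=
      casselsTate_levelInputs_canonical K W p M₀ hp hp2 hMpos c hc hcc e hμ hadd₁ hadd₂ hgal halt hnondeg
    have hinv : ∀ v : HeightOneSpectrum (𝓞 K), Injective (inv (Sum.inr v)) :=
      fun v => (hperf v).1.injective
    obtain ⟨hfin, -, hle, -⟩ :=
      card_sha_primary_le_at_of_leavesM₂_of_localDuality_of_conductorNorm W hK hN hnt hp hp2 hρ
        Literature.NumberTheory.Automorphic.chebotarev_artinRep_holds (exists_weilPairing_holds W p)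
        hMpos hc hcc hx₀ hmax hleaves e hμ hadd₁ hadd₂ hgal halt hnondeg inv hPT' hinv hH3 hB hPτ
    haveI := hfin
    refine ⟨hfin, ?_⟩
    obtain ⟨k, hk⟩ := exists_card_addPrimaryComponent_eq_pow (A := (W.baseChange K).sha) p
    have hkle : k ≤ 2 * M₀ := (Nat.pow_le_pow_iff_right hp.one_lt).mp (hk ▸ hle)
    exact hpow hk hkle

/-- **Kolyvagin's bound in divisibility form for an ABSTRACT Euler system of Heegner type (POINT level)
attached to a point of finite index**: `Ш(E/K)[p^∞]` finite and `#Ш(E/K)[p^∞] ∣ p^{2·ord_p [E(K) : ℤP]}`,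
GRANTED only `hpoints` (McCallum §4's derivative data for some Euler system of Heegner-type points of `E` over
the ring class fields of `K`, modulo every `p^M`; module docstring). The class-level leaves are obtained by
McCallum's cocycle (`exists_leafA_of_points`), the duality leaves (B), (B₂) from Kolyvagin reciprocity,
which is Poitou–Tate (`kolyvaginReciprocityFinset_of_poitouTate_of_conductorNorm`,
`poitouTate_sum_localTatePairing_eq_zero_holds`); then `card_sha_primaryComponent_dvd_pow_index_of_leaves`.
[cite: McCallumLMS1991, §1 Theorem (Kolyvagin), §2 Prop. 2.2, §4, Thm. 5.4, Cor. 5.6]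
[cite: GrossLMS1991, §2 Prop. 2.1, §§3–8, §10] [cite: MilneADT2006, Ch. I Thm. 4.10(b)] -/
theorem card_sha_primaryComponent_dvd_pow_index_of_points [W.IsElliptic]
    (hK : IsImaginaryQuadratic K) {N₀ : ℕ} [NeZero N₀] (hN : W.conductorNorm ℤ = N₀)
    {Pt : (W.baseChange K).toAffine.Point} {p : ℕ}
    (hnt : ¬ IsOfFinAddOrder Pt) (hp : p.Prime) (hp2 : p ≠ 2)
    (hρ : W.HasSurjectiveModNGaloisRep p)
    (hidx : (AddSubgroup.zmultiples Pt).index ≠ 0)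
    (hpoints : ∀ {M : ℕ} (_hM : 1 ≤ M)
      (hdiv : ∀ Q : geomPoints (W.baseChange K), ∃ R, ((p ^ M : ℕ) : ℤ) • R = Q)
      (c : K ≃ₐ[ℚ] K) (_hc : c ≠ 1),
      ∃ (ε : ℤ) (τ : AlgebraicClosure K ≃+* AlgebraicClosure K) (hτ : IsLiftOfAut c τ)
        (A : ℕ → AddSubgroup (geomPoints (W.baseChange K)))
        (hA : ∀ m, KolyvaginCocycle.IsAdmissible (Field.absoluteGaloisGroup K) (A m)
          ((p ^ M : ℕ) : ℤ))
        (Pn : ℕ → geomPoints (W.baseChange K))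
        (hPn : ∀ m, Pn m ∈
          KolyvaginCocycle.invPoints (Field.absoluteGaloisGroup K) (A m) ((p ^ M : ℕ) : ℤ)),
        (ε = 1 ∨ ε = -1) ∧
        IsOfFinAddOrder (Affine.Point.map (W' := W) (c : K →ₐ[ℚ] K) Pt - ε • Pt) ∧
        (∀ m, ∀ a ∈ A m, hτ.pointsMap W a ∈ A m) ∧
        Pn 1 = toGeomPoints (W.baseChange K) Pt ∧
        (∀ m : ℕ, Squarefree m →
          (∀ q ∈ m.primeFactors, IsKolyvaginPrime N₀ W K p q ∧ FrobEqFrobInfty W K (p ^ M) q) →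
          (∃ B ∈ A m, hτ.pointsMap W (Pn m) =
            (ε * (-1) ^ m.primeFactors.card) • Pn m + ((p ^ M : ℕ) : ℤ) • B) ∧
          (∀ v : HeightOneSpectrum (𝓞 K), (m : 𝓞 K) ∉ v.asIdeal →
            kolyvaginClass (W.baseChange K) _ hdiv (hA m) (Pn m) (hPn m) ∈
              selmerLocalKer (W.baseChange K) (v.adicCompletion K) ((p ^ M : ℕ) : ℤ)) ∧
          (∀ ℓ : ℕ, ℓ.Prime → ℓ ∣ m → ∀ v : HeightOneSpectrum (𝓞 K), (ℓ : 𝓞 K) ∈ v.asIdeal →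
            ∀ a : ℕ, (((p : ℤ) ^ a) •
                kolyvaginClass (W.baseChange K) _ hdiv (hA m) (Pn m) (hPn m) ∈
                selmerLocalKer (W.baseChange K) (v.adicCompletion K) ((p ^ M : ℕ) : ℤ) ↔
              ((p : ℤ) ^ a) • kolyvaginClass (W.baseChange K) _ hdiv (hA (m / ℓ)) (Pn (m / ℓ))
                  (hPn (m / ℓ)) ∈
                (W.baseChange K).torsionLocalKer (v.adicCompletion K) ((p ^ M : ℕ) : ℤ))))) :
    Finite (AddCommGroup.primaryComponent (W.baseChange K).sha p) ∧
    Nat.card (AddCommGroup.primaryComponent (W.baseChange K).sha p) ∣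
      p ^ (2 * padicValNat p (AddSubgroup.zmultiples Pt).index) := by
  refine card_sha_primaryComponent_dvd_pow_index_of_leaves W hK hN hnt hp hp2 hρ hidx ?_
  intro M hM hdiv c₁ hc₁
  obtain ⟨ε, τ, hτ, A, hA, Pn, hPn, hε, h53, hAτ, hPn1, hm'⟩ := hpoints hM hdiv c₁ hc₁
  obtain ⟨cl, hc1, hcl⟩ := exists_leafA_of_points (N := N₀) hdiv c₁ hτ ε A hA hAτ Pn hPn hPn1
    (fun m hm'' hk ↦ (hm' m hm'' hk).1) (fun m hm'' hk ↦ (hm' m hm'' hk).2.1)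
    (fun m hm'' hk ↦ (hm' m hm'' hk).2.2)
  have hRT := fun {ℓ : ℕ} (hℓ : IsKolyvaginPrime N₀ W K p ℓ) (_ : FrobEqFrobInfty W K (p ^ M) ℓ) ↦
    kolyvaginReciprocityFinset_of_poitouTate_of_conductorNorm W hN
      (poitouTate_sum_localTatePairing_eq_zero_holds K) hp hM hℓ
  exact ⟨ε, cl, hε, h53, hc1, hcl,
    hdual_of_kolyvaginReciprocityFinset_of_conductorNorm W hN hK hp hp2 hM hc₁ (fun hℓ hℓM ↦ hRT hℓ hℓM),
    hdual₂_of_kolyvaginReciprocityFinset_of_conductorNorm W hN hK hp hp2 hM hc₁ (fun hℓ hℓM ↦ hRT hℓ hℓM)⟩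
end Summit.BirchSwinnertonDyer.BirchSwinnertonDyer.Theorems.AbstractKolyvaginOrder

end
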